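import Literature.Analysis.FluidPDE.PassiveScalarForcedTrace
import HarnessLib

/-!
# The mollified pairing identity between a sourced weak passive scalar and a later release

Analysis/FluidPDE proof-support file (everything proved). Let `a` be a weak solution of
`∂ₜa + u·∇a = κΔa + f` on `T^d × [0,T)` with datum `a₀` and steady smooth source `f`
(`Torus.IsWeakScalarTransportForcedOn`), let `σ ∈ [0,T)` and let `b` be a weak solution of the
homogeneous equation driven by the translated drift `u(σ + ·)` on `[0, T_b)` with smooth datum `g`
(a RELEASE of `g` at time `σ`, `Torus.IsWeakScalarTransportOn`). For an even smooth kernel `k`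
and a.e. `τ ∈ (0, min T_b (T-σ))` we prove the **mollified pairing identity**

  `∫ (a(σ+τ) ⋆ k) b(τ) = P_{g ⋆ k}(σ)
     + ∫_{(0,τ]} ( ∫ b(τ') (G_k + f ⋆ k)(σ+τ') + ∫ b(τ') (⟪u(σ+τ'), ∇(a(σ+τ') ⋆ k)⟫ + κ Δ(a(σ+τ') ⋆ k)) ) dτ'`

(`ae_pairing_molInt_eq`), where `G_k` is the mollified flux of `a` (`PassiveScalarForcedMollified`)
and `P_{g ⋆ k}(σ)` the trace of `t ↦ ∫ a(t) (g ⋆ k)` at `σ` (`PassiveScalarForcedTrace`). Proof: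
the mollified equations of `a` (kernel `k`) and of `b` (kernels `k_m`) are absolutely continuous in
time pointwise in `x`; the product rule for such primitives
(`FunctionSpaces.mul_eq_add_setIntegral_of_eq_add_setIntegral`), Fubini, and the limit `m → ∞`
in which `b ⋆ k_m → b` and the mollified equation of `b` tested against the smooth slices of
`a ⋆ k` becomes the weak formulation of `b` (adjoint of the mollified flux,
`PassiveScalarPairingTools.integral_mul_fluxIntegral_eq`). This is the first half of the pairing
inequalities of the age-decoupling argument (`FluidPDE/AgeDecouplingInequality`); the limit
`k → δ₀` with the DiPerna–Lions commutator is taken in `PassiveScalarReleasePairing`.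

## References

* R. J. DiPerna, P.-L. Lions, Invent. Math. 98 (1989), 511–547, §II.1, §II.3. [`DiPernaLions1989`]
* P. Bonicatto, G. Ciampa, G. Crippa, J. Evol. Equ. 24 (2024), proof of Thm. 3.3. [`BonicattoCiampaCrippa2023`]
-/

noncomputable section

open MeasureTheory TopologicalSpace Set Function Filter Topology Metric ContinuousLinearMap
  UnitAddTorus
open scoped ENNReal NNReal Convolution ContDiff InnerProductSpace

namespace Literature.Analysis.FluidPDE

namespace Torus

variable {d : Type*} [Fintype d]

namespace IsWeakScalarTransportForcedOn

variable {T κ : ℝ} {u : ℝ → UnitAddTorus d → EuclideanSpace ℝ d} {f : UnitAddTorus d → ℝ}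
  {a₀ : UnitAddTorus d → ℝ} {a : ℝ → UnitAddTorus d → ℝ}

/-- **The mollified pairing identity** between a steadily sourced weak passive scalar `a` and a
weak release `b` of a smooth profile `g` at time `σ` into the same drift: for an even smooth
kernel `k` and a.e. `τ ∈ (0, min T_b (T - σ))`,
`∫ (a(σ+τ) ⋆ k) b(τ) = P_{g ⋆ k}(σ) + ∫_{(0,τ]} (∫ b(τ') (G_k + f ⋆ k)(σ+τ') +
  ∫ b(τ') (⟪u(σ+τ'), ∇(a(σ+τ') ⋆ k)⟫ + κ Δ(a(σ+τ') ⋆ k))) dτ'`.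
[cite: DiPernaLions1989, §II.1 (13)–(14)] -/
theorem ae_pairing_molInt_eq (ha : IsWeakScalarTransportForcedOn T κ u (fun _ => f) a₀ a)
    (ha₀ : Integrable a₀ volume) (hf : FunctionSpaces.Torus.IsSmooth f)
    {σ Tb : ℝ} (hσ : 0 ≤ σ) (hσT : σ < T) (hTb : 0 < Tb)
    {g : UnitAddTorus d → ℝ} (hg : FunctionSpaces.Torus.IsSmooth g) {b : ℝ → UnitAddTorus d → ℝ}
    (hb : IsWeakScalarTransportOn Tb κ (fun τ => u (σ + τ)) g b)
    {k : UnitAddTorus d → ℝ} (hk : FunctionSpaces.Torus.IsSmooth k) (hke : ∀ z, k (-z) = k z) :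
    ∀ᵐ τ ∂(volume.restrict (Ioo 0 (min Tb (T - σ)))),
      ∫ x, (a (σ + τ) ⋆ k) x * b τ x =
        ((∫ y, a₀ y * (g ⋆ k) y) + ∫ r in Ioc 0 σ, ((∫ y, a r y *
            (⟪u r y, FunctionSpaces.Torus.gradient (g ⋆ k) y⟫_ℝ + κ * FunctionSpaces.Torus.laplacian (g ⋆ k) y)) +
            ∫ y, f y * (g ⋆ k) y)) +
        ∫ τ' in Ioc 0 τ, ((∫ y, b τ' y * ((∫ z, a (σ + τ') z *
            (-⟪u (σ + τ') z, FunctionSpaces.Torus.gradient k (y - z)⟫_ℝ + κ * FunctionSpaces.Torus.laplacian k (y - z))) +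
            ∫ z, f z * k (y - z))) +
          ∫ y, b τ' y * (⟪u (σ + τ') y, FunctionSpaces.Torus.gradient (a (σ + τ') ⋆ k) y⟫_ℝ +
            κ * FunctionSpaces.Torus.laplacian (a (σ + τ') ⋆ k) y)) := by
  haveI : (volume : Measure (UnitAddTorus d)).IsNegInvariant := Pi.isNegInvariant_volume
  -- ### horizons and measures
  set T'' : ℝ := min Tb (T - σ) with hT''
  have hT''0 : 0 < T'' := lt_min hTb (by linarith)
  have hT''b : T'' ≤ Tb := min_le_left _ _
  have hσT'' : σ + T'' ≤ T := by have := min_le_right Tb (T - σ); linarith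
  set μa : Measure ℝ := (volume : Measure ℝ).restrict (Ioo 0 T) with hμa
  set μb : Measure ℝ := (volume : Measure ℝ).restrict (Ioo 0 Tb) with hμb
  set μ'' : Measure ℝ := (volume : Measure ℝ).restrict (Ioo 0 T'') with hμ''
  have hsub''b : Ioo 0 T'' ⊆ Ioo 0 Tb := Ioo_subset_Ioo le_rfl hT''b
  have hle''b : μ'' ≤ μb := Measure.restrict_mono_set _ hsub''b
  haveI : IsFiniteMeasure μ'' := by rw [hμ'']; infer_instance
  -- ### kernels for `b`
  obtain ⟨hε, hε', hε0⟩ := molRadius_spec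
  set ε : ℕ → ℝ := fun n => 1 / (4 * ((n : ℝ) + 1)) with hε_def
  set kk : ℕ → UnitAddTorus d → ℝ := fun n => FunctionSpaces.Torus.kernel (d := d) (ε n) with hkk
  have hkS : ∀ n, FunctionSpaces.Torus.IsSmooth (kk n) := fun n => FunctionSpaces.Torus.isSmooth_kernel (hε n) (hε' n)
  have hk0 : ∀ n y, 0 ≤ kk n y := fun n y => FunctionSpaces.Torus.kernel_nonneg (hε n).le y
  have hk1 : ∀ n, ∫ y, kk n y = 1 := fun n => FunctionSpaces.Torus.integral_kernel (hε n) (hε' n)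
  have hks : ∀ n, support (kk n) ⊆ ball 0 (ε n) := fun n => FunctionSpaces.Torus.support_kernel_subset (hε n)
  have hkke : ∀ n z, kk n (-z) = kk n z := fun n z => FunctionSpaces.Torus.kernel_neg (hε n) (hε' n) z
  have hconv : ∀ (δ φ : UnitAddTorus d → ℝ) (x : UnitAddTorus d), (δ ⋆ φ) x = ∫ y, δ y * φ (x - y) :=
    fun δ φ x => by simp only [convolution_lsmul, smul_eq_mul]
  have hkc : Continuous k := hk.continuous
  obtain ⟨Ck, hCk⟩ := FunctionSpaces.Torus.exists_forall_norm_le_of_continuous hkc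
  obtain ⟨Ckg, hCkg⟩ := FunctionSpaces.Torus.exists_forall_norm_le_of_continuous hk.gradient.continuous
  obtain ⟨Ckl, hCkl⟩ := FunctionSpaces.Torus.exists_forall_norm_le_of_continuous hk.laplacian.continuous
  obtain ⟨Cg, hCg⟩ := FunctionSpaces.Torus.exists_forall_norm_le_of_continuous hg.continuous
  -- ### the `a`-side objects
  set FS : ℝ → UnitAddTorus d → ℝ := fun r x => (∫ y, a r y *
    (-⟪u r y, FunctionSpaces.Torus.gradient k (x - y)⟫_ℝ + κ * FunctionSpaces.Torus.laplacian k (x - y))) +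
    ∫ y, f y * k (x - y) with hFS
  set Φ : ℝ → UnitAddTorus d → ℝ := fun r x => (∫ y, a₀ y * k (x - y)) + ∫ τ in Ioc 0 r, FS τ x with hΦ
  set MA : ℝ → UnitAddTorus d → ℝ := fun τ x => ∫ y, a (σ + τ) y * k (x - y) with hMA
  obtain ⟨Ca, hCa⟩ := ha.exists_eLpNorm_le
  obtain ⟨boundA, hbAi, hbA⟩ := ha.exists_flux_bound₁ hk
  have hFSi : ∀ x, IntegrableOn (fun r => FS r x) (Ioo 0 T) volume := fun x =>
    (ha.integrable_mul_flux hk x).integral_prod_left.add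
      (ha.integrable_source_mul_continuous (hkc.comp (continuous_const.sub continuous_id))).integral_prod_left
  have hFSm : AEStronglyMeasurable (uncurry FS) (μa.prod volume) :=
    (ha.aestronglyMeasurable_uncurry_flux₁ hk).add (ha.aestronglyMeasurable_uncurry_sourceMol hkc)
  have hgoodA : ∀ᵐ r ∂μa, (Integrable (a r) volume ∧ AEStronglyMeasurable (u r) volume ∧
      Integrable (fun y => ‖u r y‖ * a r y) volume) ∧ MemLp (a r) 2 volume ∧ eLpNorm (a r) 2 volume ≤ Ca ∧
      (∀ x, ∫ y, a r y * k (x - y) = Φ r x) ∧ (∀ x, ‖FS r x‖ ≤ boundA r) := by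
    filter_upwards [ha.ae_slice_integrable₁, ha.ae_memLp_two, hCa,
      ha.ae_forall_molInt_eq_datum_add_setIntegral_flux ha₀ hk, hbA] with r h1 h2 h3 h4 h5
    exact ⟨⟨h1.1, h1.2.1, h1.2.2.1⟩, h2, h3, fun x => by simpa only using h4 x, fun x => by simpa only using h5 x⟩
  have hgoodA'' : ∀ᵐ τ ∂μ'', (Integrable (a (σ + τ)) volume ∧ AEStronglyMeasurable (u (σ + τ)) volume ∧
      Integrable (fun y => ‖u (σ + τ) y‖ * a (σ + τ) y) volume) ∧ MemLp (a (σ + τ)) 2 volume ∧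
      eLpNorm (a (σ + τ)) 2 volume ≤ Ca ∧
      (∀ x, ∫ y, a (σ + τ) y * k (x - y) = Φ (σ + τ) x) ∧ (∀ x, ‖FS (σ + τ) x‖ ≤ boundA (σ + τ)) :=
    ae_restrict_Ioo_comp_add_left hgoodA hσ hσT''
  -- ### the `b`-side objects
  set Gb : ℕ → ℝ → UnitAddTorus d → ℝ := fun m τ x => ∫ y, b τ y *
    (-⟪u (σ + τ) y, FunctionSpaces.Torus.gradient (kk m) (x - y)⟫_ℝ + κ * FunctionSpaces.Torus.laplacian (kk m) (x - y))
    with hGb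
  set Ψ : ℕ → ℝ → UnitAddTorus d → ℝ := fun m τ x => (∫ y, g y * kk m (x - y)) + ∫ τ' in Ioc 0 τ, Gb m τ' x with hΨ
  set MB : ℕ → ℝ → UnitAddTorus d → ℝ := fun m τ x => ∫ y, b τ y * kk m (x - y) with hMB
  obtain ⟨Cb, hCb⟩ := hb.exists_eLpNorm_le
  choose boundB hbBi hbB using fun m => hb.exists_flux_bound₁ (hkS m)
  have hgoodB : ∀ᵐ τ ∂μb, (Integrable (b τ) volume ∧ AEStronglyMeasurable (u (σ + τ)) volume ∧
      Integrable (fun y => ‖u (σ + τ) y‖ * b τ y) volume) ∧ MemLp (b τ) 2 volume ∧ eLpNorm (b τ) 2 volume ≤ Cb ∧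
      (∀ m x, MB m τ x = Ψ m τ x) ∧ (∀ m x, ‖Gb m τ x‖ ≤ boundB m τ) ∧
      Tendsto (fun m => eLpNorm (b τ ⋆ kk m - b τ) 2 volume) atTop (𝓝 0) := by
    have h4 : ∀ᵐ τ ∂μb, ∀ m, ∀ x, MB m τ x = Ψ m τ x :=
      ae_all_iff.2 fun m => (hb.ae_forall_molInt_eq_datum_add_setIntegral_flux hg.continuous.integrable_unitAddTorus (hkS m)).mono
        fun τ hτ x => by simpa only using hτ x
    have h5 : ∀ᵐ τ ∂μb, ∀ m, ∀ x, ‖Gb m τ x‖ ≤ boundB m τ :=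
      ae_all_iff.2 fun m => (hbB m).mono fun τ hτ x => by simpa only using hτ x
    filter_upwards [hb.ae_slice_integrable₁, hb.ae_memLp_two, hCb, h4, h5] with τ h1 h2 h3 h4 h5
    refine ⟨⟨h1.1, h1.2.1, h1.2.2⟩, h2, h3, h4, h5, ?_⟩
    exact FunctionSpaces.Torus.tendsto_eLpNorm_convolution_sub_self h2 hk0 hk1 hks
      (fun n => FunctionSpaces.Torus.continuous_kernel (hε n) (hε' n)) hε0
  have hgoodB'' : ∀ᵐ τ ∂μ'', (Integrable (b τ) volume ∧ AEStronglyMeasurable (u (σ + τ)) volume ∧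
      Integrable (fun y => ‖u (σ + τ) y‖ * b τ y) volume) ∧ MemLp (b τ) 2 volume ∧ eLpNorm (b τ) 2 volume ≤ Cb ∧
      (∀ m x, MB m τ x = Ψ m τ x) ∧ (∀ m x, ‖Gb m τ x‖ ≤ boundB m τ) ∧
      Tendsto (fun m => eLpNorm (b τ ⋆ kk m - b τ) 2 volume) atTop (𝓝 0) :=
    ae_restrict_of_ae_restrict_of_subset hsub''b hgoodB
  -- ### measurability of the translated objects
  have hFSm'' : AEStronglyMeasurable (uncurry fun τ x => FS (σ + τ) x) (μ''.prod volume) :=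
    aestronglyMeasurable_uncurry_comp_add_left hFSm hσ hσT''
  have hMAm : AEStronglyMeasurable (uncurry MA) (μ''.prod volume) :=
    aestronglyMeasurable_uncurry_comp_add_left (ha.aestronglyMeasurable_uncurry_molInt₁ hkc) hσ hσT''
  have hMBm : ∀ m, AEStronglyMeasurable (uncurry (MB m)) (μ''.prod volume) := fun m =>
    (hb.aestronglyMeasurable_uncurry_molInt₁ (hkS m).continuous).mono_measure (Measure.prod_mono hle''b le_rfl)
  have hGbm : ∀ m, AEStronglyMeasurable (uncurry (Gb m)) (μ''.prod volume) := fun m =>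
    (hb.aestronglyMeasurable_uncurry_flux₁ (hkS m)).mono_measure (Measure.prod_mono hle''b le_rfl)
  have hbAi'' : IntegrableOn (fun τ => boundA (σ + τ)) (Ioo 0 T'') volume :=
    integrableOn_Ioo_comp_add_left (hbAi.mono_set (Ioo_subset_Ioo hσ hσT''))
  -- `L¹` bounds of the slices
  have hCa1 : ∀ᵐ τ ∂μ'', ∫ y, |a (σ + τ) y| ≤ Ca := by
    filter_upwards [hgoodA''] with τ hτ
    exact integral_abs_le_of_eLpNorm_le hτ.2.1 hτ.2.2.1
  have hCb1 : ∀ᵐ τ ∂μ'', ∫ y, |b τ y| ≤ Cb := by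
    filter_upwards [hgoodB''] with τ hτ
    exact integral_abs_le_of_eLpNorm_le hτ.2.1 hτ.2.2.1
  -- sup bounds of the mollified slices
  have hMAle : ∀ᵐ τ ∂μ'', ∀ x, |MA τ x| ≤ Ck * Ca := by
    filter_upwards [hgoodA'', hCa1] with τ hτ hτ1 x
    have h1 := FunctionSpaces.Torus.norm_convolution_le hτ.1.1 hCk x
    rw [hconv] at h1
    refine (Real.norm_eq_abs _ ▸ h1).trans (mul_le_mul_of_nonneg_left ?_ ((norm_nonneg _).trans (hCk 0)))
    refine le_trans (le_of_eq (integral_congr_ae (Eventually.of_forall fun y => Real.norm_eq_abs _))) hτ1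
  have hMBle : ∀ m, ∃ C : ℝ, ∀ᵐ τ ∂μ'', ∀ x, |MB m τ x| ≤ C := by
    intro m
    obtain ⟨Ckm, hCkm⟩ := FunctionSpaces.Torus.exists_forall_norm_le_of_continuous (hkS m).continuous
    refine ⟨Ckm * Cb, ?_⟩
    filter_upwards [hgoodB'', hCb1] with τ hτ hτ1 x
    have h1 := FunctionSpaces.Torus.norm_convolution_le hτ.1.1 hCkm x
    rw [hconv] at h1
    refine (Real.norm_eq_abs _ ▸ h1).trans (mul_le_mul_of_nonneg_left ?_ ((norm_nonneg _).trans (hCkm 0)))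
    refine le_trans (le_of_eq (integral_congr_ae (Eventually.of_forall fun y => Real.norm_eq_abs _))) hτ1
  -- ### the good times
  filter_upwards [hgoodA'', hgoodB'', ae_restrict_mem measurableSet_Ioo, hMAle] with τ hA hB hτ hMAτle
  obtain ⟨⟨hai, hau, hauθ⟩, ha2, haC, harep, haFS⟩ := hA
  obtain ⟨⟨hbi, hbu, hbuθ⟩, hb2, hbC, hbrep, hbGb, hblim⟩ := hB
  have hsubτ : Ioc 0 τ ⊆ Ioo 0 T'' := Ioc_subset_Ioo_right hτ.2
  have hleτ : (volume : Measure ℝ).restrict (Ioc 0 τ) ≤ μ'' := Measure.restrict_mono_set _ hsubτ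
  haveI : IsFiniteMeasure ((volume : Measure ℝ).restrict (Ioc 0 τ)) := by infer_instance
  -- continuity of the slice objects at the good time `τ`
  have hMAτ : Continuous (MA τ) := by
    have e : MA τ = a (σ + τ) ⋆ k := funext fun x => (hconv _ _ x).symm
    rw [e]; exact FunctionSpaces.Torus.continuous_convolution hai hkc
  -- ### Step 1: the identity for every `m`
  set βm : ℕ → UnitAddTorus d → ℝ := fun m x => ∫ y, g y * kk m (x - y) with hβm
  set J : ℕ → ℝ → UnitAddTorus d → ℝ := fun m s x => FS (σ + s) x * MB m s x + MA s x * Gb m s x with hJ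
  have hΦi : Integrable (Φ σ) volume := by
    have h1 : Continuous fun x => ∫ y, a₀ y * k (x - y) := by
      have e : (fun x => ∫ y, a₀ y * k (x - y)) = a₀ ⋆ k := funext fun x => (hconv _ _ x).symm
      rw [e]; exact FunctionSpaces.Torus.continuous_convolution ha₀ hkc
    have h2 := ha.integrable_setIntegral_fluxSource hk hσT
    exact h1.integrable_unitAddTorus.add (by simpa only using h2)
  have hJi : ∀ m, Integrable (uncurry (J m)) (((volume : Measure ℝ).restrict (Ioc 0 τ)).prod volume) := by
    intro m
    obtain ⟨CB, hCB⟩ := hMBle m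
    have hm : AEStronglyMeasurable (uncurry (J m)) (((volume : Measure ℝ).restrict (Ioc 0 τ)).prod volume) :=
      ((hFSm''.mul (hMBm m)).add (hMAm.mul (hGbm m))).mono_measure (Measure.prod_mono hleτ le_rfl)
    set dom : ℝ → ℝ := fun s => boundA (σ + s) * |CB| + (Ck * Ca) * boundB m s with hdom
    have hdomi : Integrable dom ((volume : Measure ℝ).restrict (Ioc 0 τ)) := by
      refine Integrable.mono_measure ?_ hleτ
      exact ((hbAi''.mul_const _)).add (((hbBi m).mono_set hsub''b).const_mul _)
    refine Integrable.mono' (hdomi.mul_prod (integrable_const (1 : ℝ)) |>.congr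
      (Eventually.of_forall fun p => mul_one _)) hm ?_
    have hae : ∀ᵐ s ∂((volume : Measure ℝ).restrict (Ioc 0 τ)), ∀ x, ‖uncurry (J m) (s, x)‖ ≤ dom s := by
      filter_upwards [ae_restrict_of_ae_restrict_of_subset hsubτ hgoodA'',
        ae_restrict_of_ae_restrict_of_subset hsubτ hgoodB'', ae_restrict_of_ae_restrict_of_subset hsubτ hMAle,
        ae_restrict_of_ae_restrict_of_subset hsubτ hCB] with s hsA hsB hsMA hsMB x
      simp only [uncurry, hJ]
      refine (norm_add_le _ _).trans (add_le_add ?_ ?_)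
      · rw [norm_mul]
        exact mul_le_mul (hsA.2.2.2.2 x) ((Real.norm_eq_abs _).trans_le ((hsMB x).trans (le_abs_self _)))
          (norm_nonneg _) ((norm_nonneg _).trans (hsA.2.2.2.2 x))
      · rw [norm_mul, Real.norm_eq_abs]
        exact mul_le_mul (hsMA x) (hsB.2.2.2.2.1 m x) (norm_nonneg _) (by
          have := (abs_nonneg _).trans (hsMA x); exact this)
    have := (Measure.quasiMeasurePreserving_fst (μ := (volume : Measure ℝ).restrict (Ioc 0 τ))
      (ν := (volume : Measure (UnitAddTorus d)))).ae hae
    filter_upwards [this] with p hp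
    exact hp p.2
  have hId : ∀ m, ∫ x, MA τ x * MB m τ x = (∫ x, Φ σ x * βm m x) + ∫ s in Ioc 0 τ, ∫ x, J m s x := by
    intro m
    -- pointwise in `x`: the product rule along the time primitives
    have hpt : ∀ x, MA τ x * MB m τ x = Φ σ x * βm m x + ∫ s in Ioc 0 τ, J m s x := by
      intro x
      have hφ : IntegrableOn (fun t => FS (σ + t) x) (Ioo 0 T'') volume :=
        integrableOn_Ioo_comp_add_left ((hFSi x).mono_set (Ioo_subset_Ioo hσ hσT''))
      have hγ : IntegrableOn (fun t => Gb m t x) (Ioo 0 T'') volume :=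
        ((hb.integrable_mul_flux (hkS m) x).integral_prod_left).mono_measure (Measure.restrict_mono_set _ hsub''b)
      have hF : ∀ t ∈ Ioc 0 T'', Φ (σ + t) x = Φ σ x + ∫ s in Ioc 0 t, FS (σ + s) x := by
        intro t ht
        simp only [hΦ]
        rw [setIntegral_Ioc_eq_add_comp_add_left (hFSi x) hσ ht.1.le (by linarith [ht.2]), add_assoc]
      have hG : ∀ t ∈ Ioc 0 T'', Ψ m t x = βm m x + ∫ s in Ioc 0 t, Gb m s x := fun t _ => rfl
      have hprod := (FunctionSpaces.mul_eq_add_setIntegral_of_eq_add_setIntegral (T := T'')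
        (F := fun t => Φ (σ + t) x) (G := fun t => Ψ m t x) hφ hγ hF hG ⟨hτ.1, hτ.2.le⟩).2
      beta_reduce at hprod
      have e1 : MA τ x = Φ (σ + τ) x := harep x
      have e2 : MB m τ x = Ψ m τ x := hbrep m x
      rw [e1, e2, hprod]
      congr 1
      refine integral_congr_ae ?_
      filter_upwards [ae_restrict_of_ae_restrict_of_subset hsubτ hgoodA'',
        ae_restrict_of_ae_restrict_of_subset hsubτ hgoodB''] with s hsA hsB
      have e3 : Φ (σ + s) x = MA s x := (hsA.2.2.2.1 x).symm
      have e4 : Ψ m s x = MB m s x := (hsB.2.2.2.1 m x).symm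
      change FS (σ + s) x * Ψ m s x + Φ (σ + s) x * Gb m s x = FS (σ + s) x * MB m s x + MA s x * Gb m s x
      rw [e3, e4]
    -- integrate in `x` and swap
    have i1 : Integrable (fun x => Φ σ x * βm m x) volume := by
      obtain ⟨Cβ, hCβ⟩ := FunctionSpaces.Torus.exists_forall_norm_le_of_continuous
        (FunctionSpaces.Torus.continuous_convolution hg.continuous.integrable_unitAddTorus (hkS m).continuous)
      refine hΦi.mul_bdd (c := Cβ) ?_ (Eventually.of_forall fun x => ?_)
      · have e : βm m = g ⋆ kk m := funext fun x => (hconv _ _ x).symm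
        rw [e]; exact (FunctionSpaces.Torus.continuous_convolution hg.continuous.integrable_unitAddTorus
          (hkS m).continuous).aestronglyMeasurable
      · have e : βm m x = (g ⋆ kk m) x := (hconv _ _ x).symm
        rw [e]; exact hCβ x
    have i2 : Integrable (fun x => ∫ s in Ioc 0 τ, J m s x) volume := (hJi m).swap.integral_prod_left
    calc ∫ x, MA τ x * MB m τ x = ∫ x, (Φ σ x * βm m x + ∫ s in Ioc 0 τ, J m s x) :=
          integral_congr_ae (Eventually.of_forall hpt)
      _ = (∫ x, Φ σ x * βm m x) + ∫ x, ∫ s in Ioc 0 τ, J m s x := integral_add i1 i2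
      _ = (∫ x, Φ σ x * βm m x) + ∫ s in Ioc 0 τ, ∫ x, J m s x := by
          rw [integral_integral_swap (f := fun x s => J m s x) (hJi m).swap]
  -- ### Step 2: the limit `m → ∞` of the left-hand side
  have hE : Tendsto (fun m => ∫ x, MA τ x * MB m τ x) atTop (𝓝 (∫ x, MA τ x * b τ x)) := by
    have hCk0 : 0 ≤ Ck * Ca := (abs_nonneg _).trans (hMAτle 0)
    have i0 : Integrable (fun x => MA τ x * b τ x) volume :=
      hbi.bdd_mul (c := Ck * Ca) hMAτ.aestronglyMeasurable
        (Eventually.of_forall fun x => by rw [Real.norm_eq_abs]; exact hMAτle x)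
    have im : ∀ m, Integrable (fun x => MA τ x * MB m τ x) volume := by
      intro m
      have e : MB m τ = b τ ⋆ kk m := funext fun x => (hconv _ _ x).symm
      rw [e]
      exact (hMAτ.mul (FunctionSpaces.Torus.continuous_convolution hbi (hkS m).continuous)).integrable_unitAddTorus
    have hbound : ∀ m, |(∫ x, MA τ x * MB m τ x) - ∫ x, MA τ x * b τ x| ≤
        (Ck * Ca) * (eLpNorm (b τ ⋆ kk m - b τ) 2 volume).toReal := by
      intro m
      have hmem : MemLp (b τ ⋆ kk m - b τ) 2 volume :=
        ((FunctionSpaces.Torus.isSmooth_convolution hbi (hkS m)).memLp 2).sub hb2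
      have hfin : eLpNorm (b τ ⋆ kk m - b τ) 2 volume ≠ ⊤ := hmem.eLpNorm_ne_top
      have hL1 : ∫ x, |(b τ ⋆ kk m - b τ) x| ≤ (eLpNorm (b τ ⋆ kk m - b τ) 2 volume).toReal := by
        have := integral_abs_le_of_eLpNorm_le hmem (C := (eLpNorm (b τ ⋆ kk m - b τ) 2 volume).toNNReal)
          (le_of_eq (ENNReal.coe_toNNReal hfin).symm)
        simpa only [ENNReal.coe_toNNReal_eq_toReal] using this
      rw [← integral_sub (im m) i0]
      calc |∫ x, (MA τ x * MB m τ x - MA τ x * b τ x)| ≤ ∫ x, |MA τ x * MB m τ x - MA τ x * b τ x| :=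
            abs_integral_le_integral_abs
        _ ≤ ∫ x, (Ck * Ca) * |(b τ ⋆ kk m - b τ) x| := by
            refine integral_mono_of_nonneg (Eventually.of_forall fun x => abs_nonneg _)
              ((hmem.integrable one_le_two).abs.const_mul _) (Eventually.of_forall fun x => ?_)
            dsimp only
            rw [← mul_sub, abs_mul, Pi.sub_apply, hconv]
            exact mul_le_mul_of_nonneg_right (hMAτle x) (abs_nonneg _)
        _ = (Ck * Ca) * ∫ x, |(b τ ⋆ kk m - b τ) x| := MeasureTheory.integral_const_mul _ _
        _ ≤ (Ck * Ca) * (eLpNorm (b τ ⋆ kk m - b τ) 2 volume).toReal := mul_le_mul_of_nonneg_left hL1 hCk0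
    have h0 : Tendsto (fun m => (Ck * Ca) * (eLpNorm (b τ ⋆ kk m - b τ) 2 volume).toReal) atTop (𝓝 0) := by
      have h1 := (ENNReal.tendsto_toReal ENNReal.zero_ne_top).comp hblim
      rw [ENNReal.toReal_zero] at h1
      simpa using h1.const_mul (Ck * Ca)
    have h2 : Tendsto (fun m => (∫ x, MA τ x * MB m τ x) - ∫ x, MA τ x * b τ x) atTop (𝓝 0) :=
      squeeze_zero_norm (fun m => by rw [Real.norm_eq_abs]; exact hbound m) h0
    exact tendsto_sub_nhds_zero_iff.1 h2
  -- ### Step 3: the limit of the datum term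
  have hS : Tendsto (fun m => ∫ x, Φ σ x * βm m x) atTop (𝓝 (∫ x, Φ σ x * g x)) := by
    have hbg : ∀ m x, |βm m x| ≤ Cg := fun m x => by
      have e : βm m x = (g ⋆ kk m) x := (hconv _ _ x).symm
      rw [e]
      exact abs_convolution_le_of_forall_abs_le hg.continuous.aestronglyMeasurable
        (fun y => by rw [← Real.norm_eq_abs]; exact hCg y) (hk0 m) (hk1 m) x
    have hpg : ∀ x, Tendsto (fun m => βm m x) atTop (𝓝 (g x)) := by
      intro x
      have := tendsto_apply_of_eventually_forall_norm_sub_le (F := fun m x => (g ⋆ kk m) x) (f := g)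
        (fun η hη => by
          filter_upwards [eventually_forall_abs_convolution_sub_le hg.continuous hk0 hk1 hks hε0 hη] with m hm y
          rw [Real.norm_eq_abs]; exact hm y) x
      refine this.congr fun m => ?_
      exact hconv _ _ x
    refine tendsto_integral_of_dominated_convergence (fun x => Cg * |Φ σ x|) (fun m => ?_) (hΦi.abs.const_mul Cg)
      (fun m => Eventually.of_forall fun x => ?_) (Eventually.of_forall fun x => (hpg x).const_mul (Φ σ x))
    · have e : βm m = g ⋆ kk m := funext fun x => (hconv _ _ x).symm
      rw [e]
      exact hΦi.aestronglyMeasurable.mul (FunctionSpaces.Torus.continuous_convolution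
        hg.continuous.integrable_unitAddTorus (hkS m).continuous).aestronglyMeasurable
    · rw [norm_mul, Real.norm_eq_abs, Real.norm_eq_abs, mul_comm]
      exact mul_le_mul_of_nonneg_right (hbg m x) (abs_nonneg _)
  -- ### Step 4: the limit of the time integral
  -- the limiting integrand
  set K : ℕ → ℝ → ℝ := fun m s => ∫ x, J m s x with hK
  set Kinf : ℝ → ℝ := fun s => (∫ y, b s y * FS (σ + s) y) +
    ∫ y, b s y * (⟪u (σ + s) y, FunctionSpaces.Torus.gradient (a (σ + s) ⋆ k) y⟫_ℝ +
      κ * FunctionSpaces.Torus.laplacian (a (σ + s) ⋆ k) y) with hKinf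
  -- the uniform-in-`m` dominating function
  set dom2 : ℝ → ℝ := fun s => Cb * boundA (σ + s) + (Ckg * Ca) * (∫ y, ‖u (σ + s) y‖ * |b s y|) +
    |κ| * (Ckl * Ca) * Cb with hdom2
  have hdom2i : Integrable dom2 ((volume : Measure ℝ).restrict (Ioc 0 τ)) := by
    refine Integrable.mono_measure ?_ hleτ
    have i1 : Integrable (fun s => ∫ y, ‖u (σ + s) y‖ * |b s y|) μ'' := by
      refine Integrable.mono_measure ?_ hle''b
      refine hb.integrable_norm_velocity_mul.norm.integral_prod_left.congr (Eventually.of_forall fun s => ?_)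
      simp [Real.norm_eq_abs]
    exact ((hbAi''.const_mul Cb).add (i1.const_mul _)).add (integrable_const _)
  -- the integrand in adjoint form, its bound and its limit at good `s`
  have hgoodτ : ∀ᵐ s ∂((volume : Measure ℝ).restrict (Ioc 0 τ)),
      (∀ m, K m s = (∫ y, b s y * ((fun x => FS (σ + s) x) ⋆ kk m) y) +
        ∫ y, b s y * (⟪u (σ + s) y, FunctionSpaces.Torus.gradient (MA s ⋆ kk m) y⟫_ℝ +
          κ * FunctionSpaces.Torus.laplacian (MA s ⋆ kk m) y)) ∧
      (∀ m, ‖K m s‖ ≤ dom2 s) ∧ Tendsto (fun m => K m s) atTop (𝓝 (Kinf s)) := by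
    filter_upwards [ae_restrict_of_ae_restrict_of_subset hsubτ hgoodA'', ae_restrict_of_ae_restrict_of_subset hsubτ hgoodB'',
      ae_restrict_of_ae_restrict_of_subset hsubτ hMAle, ae_restrict_of_ae_restrict_of_subset hsubτ hCb1]
      with s hsA hsB hsMA hsCb
    obtain ⟨⟨hai', hau', hauθ'⟩, ha2', haC', harep', haFS'⟩ := hsA
    obtain ⟨⟨hbi', hbu', hbuθ'⟩, hb2', hbC', hbrep', hbGb', -⟩ := hsB
    -- continuity / smoothness of the slice objects
    have hFSc : Continuous fun x => FS (σ + s) x := by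
      refine (continuous_fluxIntegral hai' hau' hauθ' hk κ).add ?_
      have e : (fun x => ∫ y, f y * k (x - y)) = f ⋆ k := funext fun x => (hconv _ _ x).symm
      rw [e]; exact FunctionSpaces.Torus.continuous_convolution hf.continuous.integrable_unitAddTorus hkc
    have hMAe : MA s = a (σ + s) ⋆ k := funext fun x => (hconv _ _ x).symm
    have hMAs : FunctionSpaces.Torus.IsSmooth (MA s) := by
      rw [hMAe]; exact FunctionSpaces.Torus.isSmooth_convolution hai' hk
    have hMAc' : Continuous (MA s) := hMAs.continuous
    have hMBc : ∀ m, Continuous (MB m s) := fun m => by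
      have e : MB m s = b s ⋆ kk m := funext fun x => (hconv _ _ x).symm
      rw [e]; exact FunctionSpaces.Torus.continuous_convolution hbi' (hkS m).continuous
    have hGbc : ∀ m, Continuous (Gb m s) := fun m => continuous_fluxIntegral hbi' hbu' hbuθ' (hkS m) κ
    have hbabs : Integrable (fun y => ‖u (σ + s) y‖ * |b s y|) volume := by
      refine hbuθ'.norm.congr (Eventually.of_forall fun y => ?_); simp [Real.norm_eq_abs]
    -- bounds on the derivatives of `MA s` and their mollifications
    have hgradMA : ∀ y, ‖FunctionSpaces.Torus.gradient (MA s) y‖ ≤ Ckg * Ca := by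
      intro y
      rw [hMAe, FunctionSpaces.Torus.gradient_convolution hai' hk y]
      refine (FunctionSpaces.Torus.norm_convolution_le hai' hCkg y).trans (mul_le_mul_of_nonneg_left ?_ ((norm_nonneg _).trans (hCkg 0)))
      exact le_trans (le_of_eq (integral_congr_ae (Eventually.of_forall fun y => Real.norm_eq_abs _)))
        (integral_abs_le_of_eLpNorm_le ha2' haC')
    have hlapMA : ∀ y, ‖FunctionSpaces.Torus.laplacian (MA s) y‖ ≤ Ckl * Ca := by
      intro y
      rw [hMAe, FunctionSpaces.Torus.laplacian_convolution hai' hk y]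
      refine (FunctionSpaces.Torus.norm_convolution_le hai' hCkl y).trans (mul_le_mul_of_nonneg_left ?_ ((norm_nonneg _).trans (hCkl 0)))
      exact le_trans (le_of_eq (integral_congr_ae (Eventually.of_forall fun y => Real.norm_eq_abs _)))
        (integral_abs_le_of_eLpNorm_le ha2' haC')
    have hkki : ∀ m, Integrable (kk m) volume := fun m => (hkS m).continuous.integrable_unitAddTorus
    have hcomm : ∀ m, MA s ⋆ kk m = kk m ⋆ MA s := fun m => FunctionSpaces.Torus.convolution_comm_real _ _
    have hgradm : ∀ m y, FunctionSpaces.Torus.gradient (MA s ⋆ kk m) y = (kk m ⋆ FunctionSpaces.Torus.gradient (MA s)) y :=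
      fun m y => by rw [hcomm m, FunctionSpaces.Torus.gradient_convolution (hkki m) hMAs y]
    have hlapm : ∀ m y, FunctionSpaces.Torus.laplacian (MA s ⋆ kk m) y = (kk m ⋆ FunctionSpaces.Torus.laplacian (MA s)) y :=
      fun m y => by rw [hcomm m, FunctionSpaces.Torus.laplacian_convolution (hkki m) hMAs y]
    have hgradmle : ∀ m y, ‖FunctionSpaces.Torus.gradient (MA s ⋆ kk m) y‖ ≤ Ckg * Ca := fun m y => by
      rw [hgradm]
      exact norm_convolution_le_of_forall_norm_le hMAs.gradient.continuous.aestronglyMeasurable hgradMA (hk0 m) (hk1 m) y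
    have hlapmle : ∀ m y, ‖FunctionSpaces.Torus.laplacian (MA s ⋆ kk m) y‖ ≤ Ckl * Ca := fun m y => by
      rw [hlapm]
      exact norm_convolution_le_of_forall_norm_le hMAs.laplacian.continuous.aestronglyMeasurable hlapMA (hk0 m) (hk1 m) y
    have hFSle : ∀ x, |FS (σ + s) x| ≤ boundA (σ + s) := fun x => by
      rw [← Real.norm_eq_abs]; exact haFS' x
    have hFSmle : ∀ m y, |((fun x => FS (σ + s) x) ⋆ kk m) y| ≤ boundA (σ + s) := fun m y =>
      abs_convolution_le_of_forall_abs_le hFSc.aestronglyMeasurable hFSle (hk0 m) (hk1 m) y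
    -- the adjoint form
    have hadj : ∀ m, K m s = (∫ y, b s y * ((fun x => FS (σ + s) x) ⋆ kk m) y) +
        ∫ y, b s y * (⟪u (σ + s) y, FunctionSpaces.Torus.gradient (MA s ⋆ kk m) y⟫_ℝ +
          κ * FunctionSpaces.Torus.laplacian (MA s ⋆ kk m) y) := by
      intro m
      have j1 : Integrable (fun x => FS (σ + s) x * MB m s x) volume := (hFSc.mul (hMBc m)).integrable_unitAddTorus
      have j2 : Integrable (fun x => MA s x * Gb m s x) volume := (hMAc'.mul (hGbc m)).integrable_unitAddTorus
      simp only [hK, hJ]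
      rw [integral_add j1 j2]
      congr 1
      · exact integral_mul_molInt_eq hFSc hbi' (hkS m).continuous (hkke m)
      · exact integral_mul_fluxIntegral_eq hMAc' hbi' hbu' hbuθ' (hkS m) (hkke m) κ
    refine ⟨hadj, fun m => ?_, ?_⟩
    · -- the bound
      rw [hadj m, Real.norm_eq_abs]
      have i1 : Integrable (fun y => b s y * ((fun x => FS (σ + s) x) ⋆ kk m) y) volume :=
        hbi'.mul_bdd (c := boundA (σ + s)) (FunctionSpaces.Torus.continuous_convolution hFSc.integrable_unitAddTorus
          (hkS m).continuous).aestronglyMeasurable (Eventually.of_forall fun y => by rw [Real.norm_eq_abs]; exact hFSmle m y)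
      have hb1 : |∫ y, b s y * ((fun x => FS (σ + s) x) ⋆ kk m) y| ≤ Cb * boundA (σ + s) := by
        calc |∫ y, b s y * ((fun x => FS (σ + s) x) ⋆ kk m) y| ≤ ∫ y, |b s y * ((fun x => FS (σ + s) x) ⋆ kk m) y| :=
              abs_integral_le_integral_abs
          _ ≤ ∫ y, boundA (σ + s) * |b s y| := by
              refine integral_mono_of_nonneg (Eventually.of_forall fun y => abs_nonneg _) (hbi'.abs.const_mul _)
                (Eventually.of_forall fun y => ?_)
              dsimp only
              rw [abs_mul, mul_comm]
              exact mul_le_mul_of_nonneg_right (hFSmle m y) (abs_nonneg _)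
          _ = boundA (σ + s) * ∫ y, |b s y| := MeasureTheory.integral_const_mul _ _
          _ ≤ boundA (σ + s) * Cb := mul_le_mul_of_nonneg_left hsCb ((abs_nonneg _).trans (hFSle 0))
          _ = Cb * boundA (σ + s) := mul_comm _ _
      have hb2' : |∫ y, b s y * (⟪u (σ + s) y, FunctionSpaces.Torus.gradient (MA s ⋆ kk m) y⟫_ℝ +
          κ * FunctionSpaces.Torus.laplacian (MA s ⋆ kk m) y)| ≤
          (Ckg * Ca) * (∫ y, ‖u (σ + s) y‖ * |b s y|) + |κ| * (Ckl * Ca) * Cb := by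
        calc |∫ y, b s y * (⟪u (σ + s) y, FunctionSpaces.Torus.gradient (MA s ⋆ kk m) y⟫_ℝ +
              κ * FunctionSpaces.Torus.laplacian (MA s ⋆ kk m) y)|
            ≤ ∫ y, |b s y * (⟪u (σ + s) y, FunctionSpaces.Torus.gradient (MA s ⋆ kk m) y⟫_ℝ +
              κ * FunctionSpaces.Torus.laplacian (MA s ⋆ kk m) y)| := abs_integral_le_integral_abs
          _ ≤ ∫ y, ((Ckg * Ca) * (‖u (σ + s) y‖ * |b s y|) + |κ| * (Ckl * Ca) * |b s y|) := by
              refine integral_mono_of_nonneg (Eventually.of_forall fun y => abs_nonneg _)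
                ((hbabs.const_mul _).add (hbi'.abs.const_mul _)) (Eventually.of_forall fun y => ?_)
              dsimp only
              rw [abs_mul]
              have h1 : |⟪u (σ + s) y, FunctionSpaces.Torus.gradient (MA s ⋆ kk m) y⟫_ℝ| ≤ ‖u (σ + s) y‖ * (Ckg * Ca) :=
                (abs_real_inner_le_norm _ _).trans (mul_le_mul_of_nonneg_left (hgradmle m y) (norm_nonneg _))
              have h2 : |κ * FunctionSpaces.Torus.laplacian (MA s ⋆ kk m) y| ≤ |κ| * (Ckl * Ca) := by
                rw [abs_mul]
                exact mul_le_mul_of_nonneg_left (by rw [← Real.norm_eq_abs]; exact hlapmle m y) (abs_nonneg _)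
              calc |b s y| * |⟪u (σ + s) y, FunctionSpaces.Torus.gradient (MA s ⋆ kk m) y⟫_ℝ +
                    κ * FunctionSpaces.Torus.laplacian (MA s ⋆ kk m) y|
                  ≤ |b s y| * (‖u (σ + s) y‖ * (Ckg * Ca) + |κ| * (Ckl * Ca)) :=
                    mul_le_mul_of_nonneg_left ((abs_add_le _ _).trans (add_le_add h1 h2)) (abs_nonneg _)
                _ = (Ckg * Ca) * (‖u (σ + s) y‖ * |b s y|) + |κ| * (Ckl * Ca) * |b s y| := by ring
          _ = (Ckg * Ca) * (∫ y, ‖u (σ + s) y‖ * |b s y|) + |κ| * (Ckl * Ca) * ∫ y, |b s y| := by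
              rw [integral_add (hbabs.const_mul _) (hbi'.abs.const_mul _), MeasureTheory.integral_const_mul,
                MeasureTheory.integral_const_mul]
          _ ≤ (Ckg * Ca) * (∫ y, ‖u (σ + s) y‖ * |b s y|) + |κ| * (Ckl * Ca) * Cb := by
              have h0 : 0 ≤ |κ| * (Ckl * Ca) := mul_nonneg (abs_nonneg _) ((norm_nonneg _).trans (hlapMA 0))
              linarith [mul_le_mul_of_nonneg_left hsCb h0]
      calc _ ≤ |∫ y, b s y * ((fun x => FS (σ + s) x) ⋆ kk m) y| +
            |∫ y, b s y * (⟪u (σ + s) y, FunctionSpaces.Torus.gradient (MA s ⋆ kk m) y⟫_ℝ +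
              κ * FunctionSpaces.Torus.laplacian (MA s ⋆ kk m) y)| := abs_add_le _ _
        _ ≤ Cb * boundA (σ + s) + ((Ckg * Ca) * (∫ y, ‖u (σ + s) y‖ * |b s y|) + |κ| * (Ckl * Ca) * Cb) :=
            add_le_add hb1 hb2'
        _ = dom2 s := by simp only [hdom2]; ring
    · -- the limit `m → ∞`
      have hlim1 : Tendsto (fun m => ∫ y, b s y * ((fun x => FS (σ + s) x) ⋆ kk m) y) atTop
          (𝓝 (∫ y, b s y * FS (σ + s) y)) := by
        have hp : ∀ y, Tendsto (fun m => ((fun x => FS (σ + s) x) ⋆ kk m) y) atTop (𝓝 (FS (σ + s) y)) :=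
          tendsto_apply_of_eventually_forall_norm_sub_le (f := fun x => FS (σ + s) x) fun η hη => by
            filter_upwards [eventually_forall_abs_convolution_sub_le hFSc hk0 hk1 hks hε0 hη] with m hm y
            rw [Real.norm_eq_abs]; exact hm y
        refine tendsto_integral_of_dominated_convergence (fun y => boundA (σ + s) * |b s y|) (fun m => ?_)
          (hbi'.abs.const_mul _) (fun m => Eventually.of_forall fun y => ?_)
          (Eventually.of_forall fun y => (hp y).const_mul (b s y))
        · exact hbi'.aestronglyMeasurable.mul (FunctionSpaces.Torus.continuous_convolution hFSc.integrable_unitAddTorus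
            (hkS m).continuous).aestronglyMeasurable
        · rw [norm_mul, Real.norm_eq_abs, Real.norm_eq_abs, mul_comm]
          exact mul_le_mul_of_nonneg_right (hFSmle m y) (abs_nonneg _)
      have hlim2 : Tendsto (fun m => ∫ y, b s y * (⟪u (σ + s) y, FunctionSpaces.Torus.gradient (MA s ⋆ kk m) y⟫_ℝ +
          κ * FunctionSpaces.Torus.laplacian (MA s ⋆ kk m) y)) atTop
          (𝓝 (∫ y, b s y * (⟪u (σ + s) y, FunctionSpaces.Torus.gradient (MA s) y⟫_ℝ +
            κ * FunctionSpaces.Torus.laplacian (MA s) y))) := by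
        have hpg : ∀ y, Tendsto (fun m => FunctionSpaces.Torus.gradient (MA s ⋆ kk m) y) atTop
            (𝓝 (FunctionSpaces.Torus.gradient (MA s) y)) := by
          intro y
          have := tendsto_apply_of_eventually_forall_norm_sub_le
            (fun η hη => eventually_forall_norm_convolution_sub_le hMAs.gradient.continuous hk0 hk1 hks hε0 hη) y
          simpa only [← hgradm] using this
        have hpl : ∀ y, Tendsto (fun m => FunctionSpaces.Torus.laplacian (MA s ⋆ kk m) y) atTop
            (𝓝 (FunctionSpaces.Torus.laplacian (MA s) y)) := by
          intro y
          have := tendsto_apply_of_eventually_forall_norm_sub_le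
            (fun η hη => eventually_forall_norm_convolution_sub_le hMAs.laplacian.continuous hk0 hk1 hks hε0 hη) y
          simpa only [← hlapm] using this
        refine tendsto_integral_of_dominated_convergence
          (fun y => (Ckg * Ca) * (‖u (σ + s) y‖ * |b s y|) + |κ| * (Ckl * Ca) * |b s y|) (fun m => ?_)
          ((hbabs.const_mul _).add (hbi'.abs.const_mul _)) (fun m => Eventually.of_forall fun y => ?_)
          (Eventually.of_forall fun y => ?_)
        · have hsm : FunctionSpaces.Torus.IsSmooth (MA s ⋆ kk m) :=
            FunctionSpaces.Torus.isSmooth_convolution hMAc'.integrable_unitAddTorus (hkS m)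
          exact hbi'.aestronglyMeasurable.mul ((hbu'.inner hsm.gradient.continuous.aestronglyMeasurable).add
            (aestronglyMeasurable_const.mul hsm.laplacian.continuous.aestronglyMeasurable))
        · rw [norm_mul, Real.norm_eq_abs, Real.norm_eq_abs]
          have h1 : |⟪u (σ + s) y, FunctionSpaces.Torus.gradient (MA s ⋆ kk m) y⟫_ℝ| ≤ ‖u (σ + s) y‖ * (Ckg * Ca) :=
            (abs_real_inner_le_norm _ _).trans (mul_le_mul_of_nonneg_left (hgradmle m y) (norm_nonneg _))
          have h2 : |κ * FunctionSpaces.Torus.laplacian (MA s ⋆ kk m) y| ≤ |κ| * (Ckl * Ca) := by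
            rw [abs_mul]
            exact mul_le_mul_of_nonneg_left (by rw [← Real.norm_eq_abs]; exact hlapmle m y) (abs_nonneg _)
          calc |b s y| * |⟪u (σ + s) y, FunctionSpaces.Torus.gradient (MA s ⋆ kk m) y⟫_ℝ +
                κ * FunctionSpaces.Torus.laplacian (MA s ⋆ kk m) y|
              ≤ |b s y| * (‖u (σ + s) y‖ * (Ckg * Ca) + |κ| * (Ckl * Ca)) :=
                mul_le_mul_of_nonneg_left ((abs_add_le _ _).trans (add_le_add h1 h2)) (abs_nonneg _)
            _ = (Ckg * Ca) * (‖u (σ + s) y‖ * |b s y|) + |κ| * (Ckl * Ca) * |b s y| := by ring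
        · have h3 : Tendsto (fun m => ⟪u (σ + s) y, FunctionSpaces.Torus.gradient (MA s ⋆ kk m) y⟫_ℝ) atTop
              (𝓝 ⟪u (σ + s) y, FunctionSpaces.Torus.gradient (MA s) y⟫_ℝ) := (tendsto_const_nhds).inner (hpg y)
          exact (h3.add ((hpl y).const_mul κ)).const_mul (b s y)
      have hsum := hlim1.add hlim2
      rw [hMAe] at hsum
      refine (hsum.congr fun m => (hadj m).symm.trans ?_).trans_eq ?_ <;> rfl
  -- dominated convergence in `s`
  have hKlim : Tendsto (fun m => ∫ s in Ioc 0 τ, K m s) atTop (𝓝 (∫ s in Ioc 0 τ, Kinf s)) := by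
    refine tendsto_integral_of_dominated_convergence dom2 (fun m => ?_) hdom2i (fun m => ?_) ?_
    · exact (hJi m).integral_prod_left.aestronglyMeasurable
    · exact hgoodτ.mono fun s hs => hs.2.1 m
    · exact hgoodτ.mono fun s hs => hs.2.2
  -- ### Step 5: conclusion
  have hlimR : Tendsto (fun m => (∫ x, Φ σ x * βm m x) + ∫ s in Ioc 0 τ, K m s) atTop
      (𝓝 ((∫ x, Φ σ x * g x) + ∫ s in Ioc 0 τ, Kinf s)) := hS.add hKlim
  have heq : ∫ x, MA τ x * b τ x = (∫ x, Φ σ x * g x) + ∫ s in Ioc 0 τ, Kinf s :=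
    tendsto_nhds_unique hE (hlimR.congr fun m => (hId m).symm)
  -- identify the three terms
  have eL : ∫ x, (a (σ + τ) ⋆ k) x * b τ x = ∫ x, MA τ x * b τ x := by
    refine integral_congr_ae (Eventually.of_forall fun x => ?_)
    dsimp only
    rw [hconv]
  have eS : ∫ x, Φ σ x * g x = (∫ y, a₀ y * (g ⋆ k) y) + ∫ r in Ioc 0 σ, ((∫ y, a r y *
      (⟪u r y, FunctionSpaces.Torus.gradient (g ⋆ k) y⟫_ℝ + κ * FunctionSpaces.Torus.laplacian (g ⋆ k) y)) +
      ∫ y, f y * (g ⋆ k) y) := by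
    have h := ha.integral_molIntRep_mul_eq_trace ha₀ hk hke hg hσT
    simpa only using h
  rw [eL, heq, eS]




end IsWeakScalarTransportForcedOn

end Torus

end Literature.Analysis.FluidPDE
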